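import Literature.AlgebraicGeometry.Frobenioids.Cor54SubSquareProofs
import Literature.AlgebraicGeometry.Frobenioids.Prop53SubProofs
import Literature.AlgebraicGeometry.Frobenioids.Cor54SubTransportProofs
import Literature.AlgebraicGeometry.Frobenioids.Cor54SubRealSpanCompatProofs
import Literature.AlgebraicGeometry.Frobenioids.Cor54SubOneUniqueProofs
import Literature.AlgebraicGeometry.Frobenioids.UnitTrivializationModelComparisonCanonical
import Literature.AlgebraicGeometry.Frobenioids.Cor54SubRigidProofs
import Literature.AlgebraicGeometry.Frobenioids.Cor54SubBiratCompatProofs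
import HarnessLib

/-!
# Frobenioids I, Corollary 5.4 at THE constructions: `Ψ^rlf` exists, is an equivalence, is 1-unique,
# and the square with THE natural functors `C_i^istr → C_i^rlf` 1-commutes

Mochizuki, *The geometry of Frobenioids I: the general theory*, Kyushu J. Math. **62** (2008)
293–400, Cor. 5.4, kurims p. 104 l. 2–6: "there exists a 1-unique functor `Ψ^rlf : C₁^rlf → C₂^rlf` that
fits into a 1-commutative diagram [`C₁ → C₂` over `C₁^rlf → C₂^rlf`, where the vertical arrows are the
natural functors of Proposition 5.3; the horizontal arrows are equivalences of categories]"; proof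
l. 21–22: "Corollary 5.4 follows immediately from Corollaries 4.10; 4.11, (iii), (iv)."
[cite: MochizukiFrdI2008, Cor. 5.4 p.104]

PROOF-ONLY assembly (seat abc-iut-L1-t10 gen 3; rows C54/L05 + L06 + L07 of the W3 sub-DAG of seat
abc-iut-w5-d137 read TOGETHER at THE constructions the tree names):
* `(Ψ^Φ)^rlf := FrdI.Cor54Sub.rlfIso … E` (row C54/L02, `Prop53SubProofs.lean`), lying over `Ψ^Φ = E` by
  `rlfIso_toRlf`;
* THE comparison equivalences `e_i := PreFrobenioid.untrComparison F_i hF_i : C_i^un-tr ≌ untrModel F_i`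
  with their compatibility `untrComparison_compToElem` (seat abc-iut-L1-d5), so that the vertical arrows of
  the square are THE `ι_i = FrdI.Prop53Sub.iotaRlf F_i hΦ_i (untrComparison F_i hF_i)`;
* THE transport `Ψ^rlf` of row C54/L05 (`rlfTransport_holds`, seat abc-iut-w5-d137), fed by row C54/L04
  (`realSpanCompat_holds`, seat abc-iut-w5-d097) from the `Φ^birat`-compatibility of row C54/L03
  (`BiratCompat`, a binder here; discharged from Cor. 4.10 by `biratCompat_of`, seat abc-iut-w5-d221);
* the square by `square_holds` (row C54/L06, `Cor54SubSquareProofs.lean`) and the 1-uniqueness among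
  functors induced by the same data by `oneUniqueData_holds` (row C54/L07, seat abc-iut-w5-d221).
What stays a binder is exactly the Cor. 4.11 package the print invokes: `Ψ`, its restriction `Ψ^istr`
(`hΨistr`), `Ψ^un-tr` with the square `s` of Cor. 4.11 (i), and `(Ψ^Base, Ψ^Φ = E, η, hdeg, hdiv)` of
Cor. 4.11 (ii)–(iv) (shapes of `PreFrobenioidData.Cor411iv`).  No statement of the paper is restated;
nothing here bears on [IUTchIII].
-/

noncomputable section

namespace Literature.AlgebraicGeometry.Frobenioids

open CategoryTheory Opposite Literature.AnabelianGeometry.EtaleTheta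

universe w v₁ v₁' u₁ u₁' v₂ v₂' u₂ u₂'

namespace FrdI.Cor54Sub

variable {D₁ : Type u₁'} [Category.{v₁'} D₁] {Φ₁ : D₁ᵒᵖ ⥤ CommMonCat.{w}}
  {C₁ : Type u₁} [Category.{v₁} C₁] (F₁ : C₁ ⥤ ElemFrobenioid Φ₁) (hΦ₁ : PreFrobenioid.IsPerfFactorialOn Φ₁)
  {D₂ : Type u₂'} [Category.{v₂'} D₂] {Φ₂ : D₂ᵒᵖ ⥤ CommMonCat.{w}}
  {C₂ : Type u₂} [Category.{v₂} C₂] (F₂ : C₂ ⥤ ElemFrobenioid Φ₂) (hΦ₂ : PreFrobenioid.IsPerfFactorialOn Φ₂)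

/-- **Cor. 5.4, the square at THE realified `Ψ^Φ` and THE comparison equivalences**: for every functor
`Ψ^rlf : C₁^rlf → C₂^rlf` induced by `(Ψ^Base, (Ψ^Φ)^rlf)` with `(Ψ^Φ)^rlf = rlfIso E`, the square
`ι₁ ⋙ Ψ^rlf ≅ Ψ^istr ⋙ ι₂` 1-commutes, `ι_i` THE natural functors `C_i^istr → C_i^rlf` of Prop. 5.3 (at
`untrComparison F_i hF_i`). [cite: MochizukiFrdI2008, Cor. 5.4 p.104] -/
theorem square_holds_canonical (hF₁ : PreFrobenioid.IsFrobenioid F₁) (hF₂ : PreFrobenioid.IsFrobenioid F₂)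
    (Ψ : C₁ ⥤ C₂)
    (Ψistr : (PreFrobenioidData.ofFunctor Φ₁ F₁).Istr ⥤ (PreFrobenioidData.ofFunctor Φ₂ F₂).Istr)
    (hΨistr : Ψistr ⋙ (PreFrobenioidData.ofFunctor Φ₂ F₂).istrι ≅ (PreFrobenioidData.ofFunctor Φ₁ F₁).istrι ⋙ Ψ)
    (Ψuntr : (PreFrobenioidData.ofFunctor Φ₁ F₁).Untr ⥤ (PreFrobenioidData.ofFunctor Φ₂ F₂).Untr)
    (s : Ψistr ⋙ (PreFrobenioidData.ofFunctor Φ₂ F₂).toUntr ≅ (PreFrobenioidData.ofFunctor Φ₁ F₁).toUntr ⋙ Ψuntr)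
    (ΨBase : D₁ ⥤ D₂)
    (E : PreFrobenioidData.DivisorMonoidIsoOverBase
      (PreFrobenioidData.ofFunctor Φ₁ F₁) (PreFrobenioidData.ofFunctor Φ₂ F₂) ΨBase)
    (η : Ψ ⋙ (PreFrobenioidData.ofFunctor Φ₂ F₂).base ≅ (PreFrobenioidData.ofFunctor Φ₁ F₁).base ⋙ ΨBase)
    (hdeg : ∀ ⦃A B : C₁⦄ (φ : A ⟶ B),
      (PreFrobenioidData.ofFunctor Φ₂ F₂).degFr (Ψ.map φ) = (PreFrobenioidData.ofFunctor Φ₁ F₁).degFr φ)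
    (hdiv : ∀ ⦃A B : C₁⦄ (φ : A ⟶ B),
      (PreFrobenioidData.ofFunctor Φ₂ F₂).div (Ψ.map φ) =
        (PreFrobenioidData.ofFunctor Φ₂ F₂).pull (η.hom.app A)
          (E.iso ((PreFrobenioidData.ofFunctor Φ₁ F₁).base.obj A) ((PreFrobenioidData.ofFunctor Φ₁ F₁).div φ)))
    (Ψrlf : PreFrobenioid.rlf F₁ hΦ₁ ⥤ PreFrobenioid.rlf F₂ hΦ₂)
    (hΨrlf : IsInducedBy F₁ hΦ₁ F₂ hΦ₂ ΨBase (rlfIso F₁ hΦ₁ F₂ hΦ₂ E) Ψrlf) :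
    Square hΦ₁ hΦ₂ Ψistr (PreFrobenioid.untrComparison F₁ hF₁) (PreFrobenioid.untrComparison F₂ hF₂) Ψrlf :=
  square_holds F₁ hΦ₁ F₂ hΦ₂ hF₁ hF₂ Ψ Ψistr hΨistr Ψuntr s
    (PreFrobenioid.untrComparison F₁ hF₁) (PreFrobenioid.untrComparison F₂ hF₂)
    (PreFrobenioid.untrComparison_compToElem hF₁).some (PreFrobenioid.untrComparison_compToElem hF₂).some
    ΨBase E η hdeg hdiv (rlfIso F₁ hΦ₁ F₂ hΦ₂ E) (rlfIso_toRlf F₁ hΦ₁ F₂ hΦ₂ E) Ψrlf hΨrlf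

/-- **Cor. 5.4 at THE constructions, modulo the Cor. 4.11 package**: granted an equivalence of bases
`Ψ^Base`, the isomorphism of divisor monoids `Ψ^Φ = E` over it with the degree/`Div` compatibilities of `Ψ`
(Cor. 4.11 (ii)–(iv)), `Ψ^istr`, `Ψ^un-tr` with the square of Cor. 4.11 (i), and the `Φ^birat`-compatibility of
`Ψ^Φ` (Cor. 4.10), THERE EXISTS `Ψ^rlf : C₁^rlf → C₂^rlf` — THE transport along `(Ψ^Base, (Ψ^Φ)^rlf)` —
which is an EQUIVALENCE, is INDUCED by that data, makes the square with THE natural functors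
`C_i^istr → C_i^rlf` 1-COMMUTE, and is 1-UNIQUE among the functors induced by the same data.
[cite: MochizukiFrdI2008, Cor. 5.4 p.104] -/
theorem exists_rlfTransport_square (hF₁ : PreFrobenioid.IsFrobenioid F₁) (hF₂ : PreFrobenioid.IsFrobenioid F₂)
    (Ψ : C₁ ⥤ C₂)
    (Ψistr : (PreFrobenioidData.ofFunctor Φ₁ F₁).Istr ⥤ (PreFrobenioidData.ofFunctor Φ₂ F₂).Istr)
    (hΨistr : Ψistr ⋙ (PreFrobenioidData.ofFunctor Φ₂ F₂).istrι ≅ (PreFrobenioidData.ofFunctor Φ₁ F₁).istrι ⋙ Ψ)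
    (Ψuntr : (PreFrobenioidData.ofFunctor Φ₁ F₁).Untr ⥤ (PreFrobenioidData.ofFunctor Φ₂ F₂).Untr)
    (s : Ψistr ⋙ (PreFrobenioidData.ofFunctor Φ₂ F₂).toUntr ≅ (PreFrobenioidData.ofFunctor Φ₁ F₁).toUntr ⋙ Ψuntr)
    (ΨBase : D₁ ≌ D₂)
    (E : PreFrobenioidData.DivisorMonoidIsoOverBase
      (PreFrobenioidData.ofFunctor Φ₁ F₁) (PreFrobenioidData.ofFunctor Φ₂ F₂) ΨBase.functor)
    (η : Ψ ⋙ (PreFrobenioidData.ofFunctor Φ₂ F₂).base ≅ (PreFrobenioidData.ofFunctor Φ₁ F₁).base ⋙ ΨBase.functor)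
    (hdeg : ∀ ⦃A B : C₁⦄ (φ : A ⟶ B),
      (PreFrobenioidData.ofFunctor Φ₂ F₂).degFr (Ψ.map φ) = (PreFrobenioidData.ofFunctor Φ₁ F₁).degFr φ)
    (hdiv : ∀ ⦃A B : C₁⦄ (φ : A ⟶ B),
      (PreFrobenioidData.ofFunctor Φ₂ F₂).div (Ψ.map φ) =
        (PreFrobenioidData.ofFunctor Φ₂ F₂).pull (η.hom.app A)
          (E.iso ((PreFrobenioidData.ofFunctor Φ₁ F₁).base.obj A) ((PreFrobenioidData.ofFunctor Φ₁ F₁).div φ)))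
    (hbirat : BiratCompat F₁ F₂ ΨBase.functor E) :
    ∃ Ψrlf : PreFrobenioid.rlf F₁ hΦ₁ ⥤ PreFrobenioid.rlf F₂ hΦ₂,
      Ψrlf.IsEquivalence ∧
        IsInducedBy F₁ hΦ₁ F₂ hΦ₂ ΨBase.functor (rlfIso F₁ hΦ₁ F₂ hΦ₂ E) Ψrlf ∧
          Square hΦ₁ hΦ₂ Ψistr (PreFrobenioid.untrComparison F₁ hF₁) (PreFrobenioid.untrComparison F₂ hF₂) Ψrlf ∧
            ∀ Ψrlf' : PreFrobenioid.rlf F₁ hΦ₁ ⥤ PreFrobenioid.rlf F₂ hΦ₂,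
              IsInducedBy F₁ hΦ₁ F₂ hΦ₂ ΨBase.functor (rlfIso F₁ hΦ₁ F₂ hΦ₂ E) Ψrlf' → Nonempty (Ψrlf ≅ Ψrlf') := by
  obtain ⟨Ψrlf, ηr, hequiv, hdegr, hdivr⟩ :=
    rlfTransport_holds hΦ₁ hΦ₂ ΨBase (rlfIso F₁ hΦ₁ F₂ hΦ₂ E)
      (realSpanCompat_holds F₁ hΦ₁ F₂ hΦ₂ E (rlfIso F₁ hΦ₁ F₂ hΦ₂ E) hbirat (rlfIso_toRlf F₁ hΦ₁ F₂ hΦ₂ E))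
  have hind : IsInducedBy F₁ hΦ₁ F₂ hΦ₂ ΨBase.functor (rlfIso F₁ hΦ₁ F₂ hΦ₂ E) Ψrlf := ⟨ηr, hdegr, hdivr⟩
  exact ⟨Ψrlf, hequiv, hind,
    square_holds_canonical F₁ hΦ₁ F₂ hΦ₂ hF₁ hF₂ Ψ Ψistr hΨistr Ψuntr s ΨBase.functor E η hdeg hdiv Ψrlf hind,
    fun Ψrlf' hind' => oneUniqueData_holds F₁ hΦ₁ F₂ hΦ₂ ΨBase.functor (rlfIso F₁ hΦ₁ F₂ hΦ₂ E) Ψrlf Ψrlf' hind hind'⟩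

/-- **… and each composite of the square is RIGID** (p. 104 l. 6–7), when `Ψ^istr` is an equivalence (the
print's case: `Ψ` an equivalence) and the realified operations are Div-slim (row C54/L08, `rigid_of`, seat
abc-iut-w5-d222). [cite: MochizukiFrdI2008, Cor. 5.4 p.104] -/
theorem rigid_canonical (hF₁ : PreFrobenioid.IsFrobenioid F₁) (hF₂ : PreFrobenioid.IsFrobenioid F₂)
    (Ψ : C₁ ⥤ C₂)
    (Ψistr : (PreFrobenioidData.ofFunctor Φ₁ F₁).Istr ⥤ (PreFrobenioidData.ofFunctor Φ₂ F₂).Istr)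
    [Ψistr.IsEquivalence]
    (hΨistr : Ψistr ⋙ (PreFrobenioidData.ofFunctor Φ₂ F₂).istrι ≅ (PreFrobenioidData.ofFunctor Φ₁ F₁).istrι ⋙ Ψ)
    (Ψuntr : (PreFrobenioidData.ofFunctor Φ₁ F₁).Untr ⥤ (PreFrobenioidData.ofFunctor Φ₂ F₂).Untr)
    (s : Ψistr ⋙ (PreFrobenioidData.ofFunctor Φ₂ F₂).toUntr ≅ (PreFrobenioidData.ofFunctor Φ₁ F₁).toUntr ⋙ Ψuntr)
    (ΨBase : D₁ ⥤ D₂)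
    (E : PreFrobenioidData.DivisorMonoidIsoOverBase
      (PreFrobenioidData.ofFunctor Φ₁ F₁) (PreFrobenioidData.ofFunctor Φ₂ F₂) ΨBase)
    (η : Ψ ⋙ (PreFrobenioidData.ofFunctor Φ₂ F₂).base ≅ (PreFrobenioidData.ofFunctor Φ₁ F₁).base ⋙ ΨBase)
    (hdeg : ∀ ⦃A B : C₁⦄ (φ : A ⟶ B),
      (PreFrobenioidData.ofFunctor Φ₂ F₂).degFr (Ψ.map φ) = (PreFrobenioidData.ofFunctor Φ₁ F₁).degFr φ)
    (hdiv : ∀ ⦃A B : C₁⦄ (φ : A ⟶ B),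
      (PreFrobenioidData.ofFunctor Φ₂ F₂).div (Ψ.map φ) =
        (PreFrobenioidData.ofFunctor Φ₂ F₂).pull (η.hom.app A)
          (E.iso ((PreFrobenioidData.ofFunctor Φ₁ F₁).base.obj A) ((PreFrobenioidData.ofFunctor Φ₁ F₁).div φ)))
    (Ψrlf : PreFrobenioid.rlf F₁ hΦ₁ ⥤ PreFrobenioid.rlf F₂ hΦ₂)
    (hΨrlf : IsInducedBy F₁ hΦ₁ F₂ hΦ₂ ΨBase (rlfIso F₁ hΦ₁ F₂ hΦ₂ E) Ψrlf)
    (hD₁ : (rlfData F₁ hΦ₁).IsDivSlim) (hD₂ : (rlfData F₂ hΦ₂).IsDivSlim) :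
    IsRigidFunctor (FrdI.Prop53Sub.iotaRlf F₁ hΦ₁ (PreFrobenioid.untrComparison F₁ hF₁) ⋙ Ψrlf) ∧
      IsRigidFunctor (Ψistr ⋙ FrdI.Prop53Sub.iotaRlf F₂ hΦ₂ (PreFrobenioid.untrComparison F₂ hF₂)) :=
  rigid_of hΦ₁ hΦ₂ Ψistr (PreFrobenioid.untrComparison F₁ hF₁) (PreFrobenioid.untrComparison F₂ hF₂) Ψrlf hD₁ hD₂
    (square_holds_canonical F₁ hΦ₁ F₂ hΦ₂ hF₁ hF₂ Ψ Ψistr hΨistr Ψuntr s ΨBase E η hdeg hdiv Ψrlf hΨrlf)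

/-- **Cor. 5.4 at THE constructions for an EQUIVALENCE `Ψ`, the `Φ^birat`-compatibility discharged** ("follows
immediately from Corollaries 4.10; 4.11, (iii), (iv)"): as `exists_rlfTransport_square`, with the binder
`BiratCompat` replaced by its source — `Ψ`, `Ψ⁻¹` preserve pre-steps and co-angular pre-steps (the conclusion
shape of Thm. 3.4 (ii), `PreFrobenioidData.Thm34ii`), via `biratCompat_of` (row C54/L03, seat abc-iut-w5-d221;
`Ψ^Base` an equivalence is full and faithful, `C₂ → F_{Φ₂}` is a pre-Frobenioid since a Frobenioid).
[cite: MochizukiFrdI2008, Cor. 5.4 p.104] -/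
theorem exists_rlfTransport_square_of_preservesPreSteps
    (hF₁ : PreFrobenioid.IsFrobenioid F₁) (hF₂ : PreFrobenioid.IsFrobenioid F₂)
    (Ψ : C₁ ≌ C₂)
    (Ψistr : (PreFrobenioidData.ofFunctor Φ₁ F₁).Istr ⥤ (PreFrobenioidData.ofFunctor Φ₂ F₂).Istr)
    (hΨistr : Ψistr ⋙ (PreFrobenioidData.ofFunctor Φ₂ F₂).istrι ≅
      (PreFrobenioidData.ofFunctor Φ₁ F₁).istrι ⋙ Ψ.functor)
    (Ψuntr : (PreFrobenioidData.ofFunctor Φ₁ F₁).Untr ⥤ (PreFrobenioidData.ofFunctor Φ₂ F₂).Untr)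
    (s : Ψistr ⋙ (PreFrobenioidData.ofFunctor Φ₂ F₂).toUntr ≅ (PreFrobenioidData.ofFunctor Φ₁ F₁).toUntr ⋙ Ψuntr)
    (ΨBase : D₁ ≌ D₂)
    (E : PreFrobenioidData.DivisorMonoidIsoOverBase
      (PreFrobenioidData.ofFunctor Φ₁ F₁) (PreFrobenioidData.ofFunctor Φ₂ F₂) ΨBase.functor)
    (η : Ψ.functor ⋙ (PreFrobenioidData.ofFunctor Φ₂ F₂).base ≅
      (PreFrobenioidData.ofFunctor Φ₁ F₁).base ⋙ ΨBase.functor)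
    (hdeg : ∀ ⦃A B : C₁⦄ (φ : A ⟶ B),
      (PreFrobenioidData.ofFunctor Φ₂ F₂).degFr (Ψ.functor.map φ) = (PreFrobenioidData.ofFunctor Φ₁ F₁).degFr φ)
    (hdiv : ∀ ⦃A B : C₁⦄ (φ : A ⟶ B),
      (PreFrobenioidData.ofFunctor Φ₂ F₂).div (Ψ.functor.map φ) =
        (PreFrobenioidData.ofFunctor Φ₂ F₂).pull (η.hom.app A)
          (E.iso ((PreFrobenioidData.ofFunctor Φ₁ F₁).base.obj A) ((PreFrobenioidData.ofFunctor Φ₁ F₁).div φ)))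
    (hpre : PreFrobenioidData.PreservesMor Ψ.functor (PreFrobenioidData.ofFunctor Φ₁ F₁).IsPreStep
      (PreFrobenioidData.ofFunctor Φ₂ F₂).IsPreStep)
    (hco : PreFrobenioidData.PreservesMor Ψ.functor
      (PreFrobenioidData.ofFunctor Φ₁ F₁).IsCoAngularPreStep
      (PreFrobenioidData.ofFunctor Φ₂ F₂).IsCoAngularPreStep)
    (hpre' : PreFrobenioidData.PreservesMor Ψ.inverse (PreFrobenioidData.ofFunctor Φ₂ F₂).IsPreStep
      (PreFrobenioidData.ofFunctor Φ₁ F₁).IsPreStep)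
    (hco' : PreFrobenioidData.PreservesMor Ψ.inverse
      (PreFrobenioidData.ofFunctor Φ₂ F₂).IsCoAngularPreStep
      (PreFrobenioidData.ofFunctor Φ₁ F₁).IsCoAngularPreStep) :
    ∃ Ψrlf : PreFrobenioid.rlf F₁ hΦ₁ ⥤ PreFrobenioid.rlf F₂ hΦ₂,
      Ψrlf.IsEquivalence ∧
        IsInducedBy F₁ hΦ₁ F₂ hΦ₂ ΨBase.functor (rlfIso F₁ hΦ₁ F₂ hΦ₂ E) Ψrlf ∧
          Square hΦ₁ hΦ₂ Ψistr (PreFrobenioid.untrComparison F₁ hF₁) (PreFrobenioid.untrComparison F₂ hF₂) Ψrlf ∧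
            ∀ Ψrlf' : PreFrobenioid.rlf F₁ hΦ₁ ⥤ PreFrobenioid.rlf F₂ hΦ₂,
              IsInducedBy F₁ hΦ₁ F₂ hΦ₂ ΨBase.functor (rlfIso F₁ hΦ₁ F₂ hΦ₂ E) Ψrlf' → Nonempty (Ψrlf ≅ Ψrlf') :=
  exists_rlfTransport_square F₁ hΦ₁ F₂ hΦ₂ hF₁ hF₂ Ψ.functor Ψistr hΨistr Ψuntr s ΨBase E η hdeg hdiv
    (biratCompat_of F₁ F₂ Ψ hF₂.isPreFrobenioid ΨBase.functor E η hdiv hpre hco hpre' hco')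

/-- The same, for `Ψ^Base` an UNBUNDLED equivalence `(ΨBase : D₁ ⥤ D₂) [ΨBase.IsEquivalence]` and `Ψ^Φ = E` over
it — literally the shape in which `PreFrobenioidData.Cor411iv` delivers `(Ψ^Base, Ψ^Φ, η)` (Cor. 4.11 (ii)–(iv)).
[cite: MochizukiFrdI2008, Cor. 5.4 p.104] -/
theorem exists_rlfTransport_square' (hF₁ : PreFrobenioid.IsFrobenioid F₁) (hF₂ : PreFrobenioid.IsFrobenioid F₂)
    (Ψ : C₁ ⥤ C₂)
    (Ψistr : (PreFrobenioidData.ofFunctor Φ₁ F₁).Istr ⥤ (PreFrobenioidData.ofFunctor Φ₂ F₂).Istr)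
    (hΨistr : Ψistr ⋙ (PreFrobenioidData.ofFunctor Φ₂ F₂).istrι ≅ (PreFrobenioidData.ofFunctor Φ₁ F₁).istrι ⋙ Ψ)
    (Ψuntr : (PreFrobenioidData.ofFunctor Φ₁ F₁).Untr ⥤ (PreFrobenioidData.ofFunctor Φ₂ F₂).Untr)
    (s : Ψistr ⋙ (PreFrobenioidData.ofFunctor Φ₂ F₂).toUntr ≅ (PreFrobenioidData.ofFunctor Φ₁ F₁).toUntr ⋙ Ψuntr)
    (ΨBase : D₁ ⥤ D₂) [ΨBase.IsEquivalence]
    (E : PreFrobenioidData.DivisorMonoidIsoOverBase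
      (PreFrobenioidData.ofFunctor Φ₁ F₁) (PreFrobenioidData.ofFunctor Φ₂ F₂) ΨBase)
    (η : Ψ ⋙ (PreFrobenioidData.ofFunctor Φ₂ F₂).base ≅ (PreFrobenioidData.ofFunctor Φ₁ F₁).base ⋙ ΨBase)
    (hdeg : ∀ ⦃A B : C₁⦄ (φ : A ⟶ B),
      (PreFrobenioidData.ofFunctor Φ₂ F₂).degFr (Ψ.map φ) = (PreFrobenioidData.ofFunctor Φ₁ F₁).degFr φ)
    (hdiv : ∀ ⦃A B : C₁⦄ (φ : A ⟶ B),
      (PreFrobenioidData.ofFunctor Φ₂ F₂).div (Ψ.map φ) =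
        (PreFrobenioidData.ofFunctor Φ₂ F₂).pull (η.hom.app A)
          (E.iso ((PreFrobenioidData.ofFunctor Φ₁ F₁).base.obj A) ((PreFrobenioidData.ofFunctor Φ₁ F₁).div φ)))
    (hbirat : BiratCompat F₁ F₂ ΨBase E) :
    ∃ Ψrlf : PreFrobenioid.rlf F₁ hΦ₁ ⥤ PreFrobenioid.rlf F₂ hΦ₂,
      Ψrlf.IsEquivalence ∧
        IsInducedBy F₁ hΦ₁ F₂ hΦ₂ ΨBase (rlfIso F₁ hΦ₁ F₂ hΦ₂ E) Ψrlf ∧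
          Square hΦ₁ hΦ₂ Ψistr (PreFrobenioid.untrComparison F₁ hF₁) (PreFrobenioid.untrComparison F₂ hF₂) Ψrlf ∧
            ∀ Ψrlf' : PreFrobenioid.rlf F₁ hΦ₁ ⥤ PreFrobenioid.rlf F₂ hΦ₂,
              IsInducedBy F₁ hΦ₁ F₂ hΦ₂ ΨBase (rlfIso F₁ hΦ₁ F₂ hΦ₂ E) Ψrlf' → Nonempty (Ψrlf ≅ Ψrlf') :=
  exists_rlfTransport_square F₁ hΦ₁ F₂ hΦ₂ hF₁ hF₂ Ψ Ψistr hΨistr Ψuntr s ΨBase.asEquivalence E η hdeg hdiv hbirat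

end FrdI.Cor54Sub

end Literature.AlgebraicGeometry.Frobenioids

end
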